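import Summits.AtomisticToContinuum.BoseEinsteinCondensation.Theses.BECRieszReverseHolder
import Literature.MathematicalPhysics.QuantumManyBody.EnergyLocalization
import Summits.AtomisticToContinuum.BoseEinsteinCondensation.Theorems.BECRieszReverseHolderMicroscaleFlatnessStubBadMassLeSliceKinetic
import Summits.AtomisticToContinuum.BoseEinsteinCondensation.Theorems.BECRieszReverseHolderMicroscaleFlatnessStubSliceKineticLeEnergy
import Summits.AtomisticToContinuum.BoseEinsteinCondensation.Theorems.BECRieszReverseHolderMicroscaleFlatnessStubGroundStateEnergyLinear

/-!
# Birth skeleton — crux `MicroscaleFlatness` (route `BECRieszReverseHolder`, item stmt-AtomisticToContinuum-12842)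

LINE (kinetic localisation; refuter rattack's paper proof, EVIDENCE.md of the item). A BAD cube `Q`
(side `s = L/m`) of the slice `y ↦ Ψ(y, X̂)` is one with a Cauchy–Schwarz deficit
`(∫_Q ‖Ψ‖)² < c₀ |Q| ∫_Q ‖Ψ‖²`. By the variance identity `∫_Q ‖f - f_Q‖² = ∫_Q ‖f‖² - ‖∫_Q f‖²/|Q|`
and the sharp Poincaré–Wirtinger inequality on the cube (Neumann gap `π²/s²`; tree:
`Literature…BoseGas.isPoincare_space`) a bad cube satisfies `(1 - c₀) ∫_Q ‖Ψ‖² ≤ (s/π)² ∫_Q |∇_y Ψ|²`;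
summing over the disjoint bad cubes and integrating over the environment gives
`stub_badMass_le_sliceKinetic` (stated with an absolute Poincaré constant `C`). Bose symmetry gives
the tagged particle exactly `1/N` of the kinetic energy (`stub_sliceKinetic_le_energy`: Fubini
along `Matrix.vecCons`, `kineticDensity = ∑ᵢ partialGradSq i`, permutation invariance, interaction
`≥ 0`), and the Dirichlet ground-state energy is `O(N)` along the thermodynamic sequence at small
density (`stub_groundStateEnergy_linear`: Ruelle's bound, tree `limsup_lt_top_of_small`). Hence the
expected bad mass of a `δ`-near-minimiser is `≤ C s² (E N + δ) / ((1 - c₀) N)`, small for small `ℓ`: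
the assembly `MicroscaleFlatness_of` chooses `c₀ = θ = 1/2`, `δ = 1`,
`ℓ = 1/(4 (C+1)(E+1))`, and uses that eventually `L ≥ 2ℓ`, so `m = ⌊L/ℓ⌋₊ ≥ 1` and `s = L/m ≤ 2ℓ`.

Positivity of `Ψ` is not needed by any stub (the bad-cube test uses `∫ ‖Ψ‖ ≥ ‖∫ Ψ‖`).
Disproof used: none on file (no `Disproof.lean` / Negative lemma for this crux at registration).
-/

namespace Summit.AtomisticToContinuum.BoseEinsteinCondensation.Cruxes.MicroscaleFlatness.Birth

open scoped BigOperators Topology Classical MeasureTheory ENNReal Matrix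
open Filter Set Function MeasureTheory

/-! ## Stub signatures (named `Prop`s, so that the composition takes its hypotheses BY NAME) -/

/-- Signature of `stub_badMass_le_sliceKinetic` (Poincaré–Wirtinger kinetic localisation on bad cubes); verbatim the type of the stub theorem below. -/
def Sig.stub_badMass_le_sliceKinetic : Prop :=
    ∃ C : ℝ, 0 < C ∧ ∀ (n : ℕ) (L : ℝ) (m : ℕ) (c₀ : ℝ)
      (Ψ : Literature.MathematicalPhysics.QuantumManyBody.BoseGas.TrialState (n + 1) L),
      0 < L → 0 < m → 0 < c₀ → c₀ < 1 →
      (∫⁻ X : Fin n → EuclideanSpace ℝ (Fin 3), (∑ k : Fin 3 → Fin m, if (∫⁻ y in {y : EuclideanSpace ℝ (Fin 3) | ∀ i, y i ∈ Set.Ico ((k i : ℝ) * (L / m)) (((k i : ℝ) + 1) * (L / m))}, (‖Ψ.ψ (Matrix.vecCons y X)‖₊ : ENNReal)) ^ 2 < ENNReal.ofReal (c₀ * (L / m) ^ 3) * ∫⁻ y in {y : EuclideanSpace ℝ (Fin 3) | ∀ i, y i ∈ Set.Ico ((k i : ℝ) * (L / m)) (((k i : ℝ) + 1) * (L / m))},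 (‖Ψ.ψ (Matrix.vecCons y X)‖₊ : ENNReal) ^ 2 then ∫⁻ y in {y : EuclideanSpace ℝ (Fin 3) | ∀ i, y i ∈ Set.Ico ((k i : ℝ) * (L / m)) (((k i : ℝ) + 1) * (L / m))}, (‖Ψ.ψ (Matrix.vecCons y X)‖₊ : ENNReal) ^ 2 else 0)) ≤
        ENNReal.ofReal (C * (L / m) ^ 2 / (1 - c₀)) *
          ∫⁻ X : Fin n → EuclideanSpace ℝ (Fin 3), ∫⁻ y : EuclideanSpace ℝ (Fin 3),
            Literature.MathematicalPhysics.QuantumManyBody.BoseGas.partialGradSq 0 Ψ.ψ (Matrix.vecCons y X)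

/-- Signature of `stub_sliceKinetic_le_energy` (the tagged particle carries `1/N` of the energy); verbatim the type of the stub theorem below. -/
def Sig.stub_sliceKinetic_le_energy : Prop :=
    ∀ (v : ℝ → ENNReal) (n : ℕ) (L : ℝ)
      (Ψ : Literature.MathematicalPhysics.QuantumManyBody.BoseGas.TrialState (n + 1) L),
      ((n + 1 : ℕ) : ENNReal) *
          ∫⁻ X : Fin n → EuclideanSpace ℝ (Fin 3), ∫⁻ y : EuclideanSpace ℝ (Fin 3),
            Literature.MathematicalPhysics.QuantumManyBody.BoseGas.partialGradSq 0 Ψ.ψ (Matrix.vecCons y X) ≤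
        Literature.MathematicalPhysics.QuantumManyBody.BoseGas.energy v Ψ

/-- Signature of `stub_groundStateEnergy_linear` (linear (Ruelle) bound on the Dirichlet ground-state energy); verbatim the type of the stub theorem below. -/
def Sig.stub_groundStateEnergy_linear : Prop :=
    ∀ v : ℝ → ENNReal, Literature.MathematicalPhysics.QuantumManyBody.BoseGas.IsRepulsiveFiniteRange v →
      ∃ ρ₀ : ℝ, 0 < ρ₀ ∧ ∀ ρ : ℝ, 0 < ρ → ρ < ρ₀ → ∃ E : ℝ, 0 < E ∧ ∀ᶠ n : ℕ in Filter.atTop,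
        Literature.MathematicalPhysics.QuantumManyBody.BoseGas.groundStateEnergy v (n + 1)
            (Literature.MathematicalPhysics.QuantumManyBody.BoseGas.sideLength ρ (n + 1)) ≤
          ENNReal.ofReal E * ((n + 1 : ℕ) : ENNReal)

/-! ## Stubs (all three LANDED under `Theorems/`; no sorries remain) -/

/-- STUB 1 — Poincaré–Wirtinger kinetic localisation on bad cubes (size M). There is an absolute
constant `C` (the sharp value is `1/π²`) such that for every trial state `Ψ` of `n+1` particles,
every `L > 0`, `m ≥ 1` and `0 < c₀ < 1`, partitioning `[0,L)³` into the `m³` cubes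
`Q_k = ∏ᵢ [kᵢ L/m, (kᵢ+1) L/m)`, the environment-integrated mass of the BAD cubes of the slice
`y ↦ Ψ(y, X)` (those with `(∫_Q ‖Ψ‖)² < c₀ |Q| ∫_Q ‖Ψ‖²`) is at most
`C (L/m)² / (1 - c₀)` times `∫ dX ∫ dy |∇₀Ψ(y, X)|²`. Per cube: variance identity + Neumann gap of
the cube (`isPoincare_space`) + `|∇(slice)|² = partialGradSq 0` (chain rule along `vecCons`);
then sum the disjoint cubes and integrate in `X`. -/
theorem stub_badMass_le_sliceKinetic :
    ∃ C : ℝ, 0 < C ∧ ∀ (n : ℕ) (L : ℝ) (m : ℕ) (c₀ : ℝ)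
      (Ψ : Literature.MathematicalPhysics.QuantumManyBody.BoseGas.TrialState (n + 1) L),
      0 < L → 0 < m → 0 < c₀ → c₀ < 1 →
      (∫⁻ X : Fin n → EuclideanSpace ℝ (Fin 3), (∑ k : Fin 3 → Fin m, if (∫⁻ y in {y : EuclideanSpace ℝ (Fin 3) | ∀ i, y i ∈ Set.Ico ((k i : ℝ) * (L / m)) (((k i : ℝ) + 1) * (L / m))}, (‖Ψ.ψ (Matrix.vecCons y X)‖₊ : ENNReal)) ^ 2 < ENNReal.ofReal (c₀ * (L / m) ^ 3) * ∫⁻ y in {y : EuclideanSpace ℝ (Fin 3) | ∀ i, y i ∈ Set.Ico ((k i : ℝ) * (L / m)) (((k i : ℝ) + 1) * (L / m))}, (‖Ψ.ψ (Matrix.vecCons y X)‖₊ : ENNReal) ^ 2 then ∫⁻ y in {y : EuclideanSpace ℝ (Fin 3) | ∀ i, y i ∈ Set.Ico ((k i : ℝ) * (L / m)) (((k i : ℝ) + 1) * (L / m))}, (‖Ψ.ψ (Matrix.vecCons y X)‖₊ : ENNReal) ^ 2 else 0)) ≤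
        ENNReal.ofReal (C * (L / m) ^ 2 / (1 - c₀)) *
          ∫⁻ X : Fin n → EuclideanSpace ℝ (Fin 3), ∫⁻ y : EuclideanSpace ℝ (Fin 3),
            Literature.MathematicalPhysics.QuantumManyBody.BoseGas.partialGradSq 0 Ψ.ψ (Matrix.vecCons y X) :=
  -- LANDED (p147654): Theorems/BECRieszReverseHolderMicroscaleFlatnessStubBadMassLeSliceKinetic.lean
  Summit.AtomisticToContinuum.BoseEinsteinCondensation.Theorems.MicroscaleFlatness.stub_badMass_le_sliceKinetic

/-- STUB 2 — the tagged particle carries `1/N` of the energy (size M). For every trial state `Ψ`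
of `n+1` bosons, `(n+1) ∫ dX ∫ dy |∇₀Ψ(y, X)|² ≤ ⟨Ψ, H Ψ⟩`: Fubini along `Matrix.vecCons`
(`lintegral_lintegral_vecCons`), `kineticDensity = ∑ᵢ partialGradSq i`
(`kineticDensity_eq_sum_partialGradSq`), each summand has the same integral by Bose symmetry
(`Ψ.symm` with a transposition, `kineticDensity_comp_perm`-style change of variables), and the
interaction term is `≥ 0`. -/
theorem stub_sliceKinetic_le_energy :
    ∀ (v : ℝ → ENNReal) (n : ℕ) (L : ℝ)
      (Ψ : Literature.MathematicalPhysics.QuantumManyBody.BoseGas.TrialState (n + 1) L),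
      ((n + 1 : ℕ) : ENNReal) *
          ∫⁻ X : Fin n → EuclideanSpace ℝ (Fin 3), ∫⁻ y : EuclideanSpace ℝ (Fin 3),
            Literature.MathematicalPhysics.QuantumManyBody.BoseGas.partialGradSq 0 Ψ.ψ (Matrix.vecCons y X) ≤
        Literature.MathematicalPhysics.QuantumManyBody.BoseGas.energy v Ψ :=
  -- LANDED (p146229): Theorems/BECRieszReverseHolderMicroscaleFlatnessStubSliceKineticLeEnergy.lean
  Summit.AtomisticToContinuum.BoseEinsteinCondensation.Theorems.MicroscaleFlatness.stub_sliceKinetic_le_energy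

/-- STUB 3 — linear (Ruelle) upper bound on the Dirichlet ground-state energy along the
thermodynamic sequence (size S–M). For a repulsive finite-range `v` (range `R`) and
`ρ (1+R)³ < 1`, `E₀(N, (N/ρ)^{1/3}) ≤ E N` for all large `N`: tree
`limsup_lt_top_of_small` (`limsup_N E₀/N < ⊤`) + `eventually_lt_of_limsup_lt`, shifted to
`N = n+1`, `E = (limsup + 1).toReal + 1`. -/
theorem stub_groundStateEnergy_linear :
    ∀ v : ℝ → ENNReal, Literature.MathematicalPhysics.QuantumManyBody.BoseGas.IsRepulsiveFiniteRange v →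
      ∃ ρ₀ : ℝ, 0 < ρ₀ ∧ ∀ ρ : ℝ, 0 < ρ → ρ < ρ₀ → ∃ E : ℝ, 0 < E ∧ ∀ᶠ n : ℕ in Filter.atTop,
        Literature.MathematicalPhysics.QuantumManyBody.BoseGas.groundStateEnergy v (n + 1)
            (Literature.MathematicalPhysics.QuantumManyBody.BoseGas.sideLength ρ (n + 1)) ≤
          ENNReal.ofReal E * ((n + 1 : ℕ) : ENNReal) :=
  -- LANDED (p146197): Theorems/BECRieszReverseHolderMicroscaleFlatnessStubGroundStateEnergyLinear.lean
  Summit.AtomisticToContinuum.BoseEinsteinCondensation.Theorems.MicroscaleFlatness.stub_groundStateEnergy_linear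

/-! Guards: each named signature is, definitionally, the type of its stub theorem. -/

example : Sig.stub_badMass_le_sliceKinetic := stub_badMass_le_sliceKinetic
example : Sig.stub_sliceKinetic_le_energy := stub_sliceKinetic_le_energy
example : Sig.stub_groundStateEnergy_linear := stub_groundStateEnergy_linear

/-! ## Composition (kernel-checked, no sorry): the three stubs imply the crux, concluded BY NAME -/

/-- ASSEMBLY (kernel-checked, no sorry): the three stubs imply the crux
`BECRieszReverseHolder.MicroscaleFlatness` by name. Choices: `c₀ = θ = 1/2`, `δ = 1`,
`ℓ = 1/(4(C+1)(E+1))`; eventually in `n`: `E₀ ≤ E(n+1)` (stub 3) and `L = sideLength ρ (n+1) ≥ 2ℓ`,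
whence `m = ⌊L/ℓ⌋₊ ≥ 1`, `L/m ≤ 2ℓ`, and
bad mass `≤ 2C(L/m)² · (E+1) ≤ 8Cℓ²(E+1) ≤ 1/2`. -/
theorem MicroscaleFlatness_of :
    Sig.stub_badMass_le_sliceKinetic → Sig.stub_sliceKinetic_le_energy → Sig.stub_groundStateEnergy_linear →
    Summit.AtomisticToContinuum.BoseEinsteinCondensation.Theses.BECRieszReverseHolder.MicroscaleFlatness := by
  intro h1 h2 h3 v hv
  obtain ⟨C, hC, hbad⟩ := h1
  obtain ⟨ρ₀, hρ₀, hρ⟩ := h3 v hv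
  refine ⟨ρ₀, hρ₀, fun ρ hρpos hρlt => ?_⟩
  obtain ⟨E, hE, hev⟩ := hρ ρ hρpos hρlt
  -- the resolution `ℓ = 1/(4(C+1)(E+1))`
  obtain ⟨ℓ, hℓ, hu⟩ : ∃ ℓ : ℝ, 0 < ℓ ∧ ℓ * (4 * (C + 1) * (E + 1)) = 1 :=
    ⟨1 / (4 * (C + 1) * (E + 1)), by positivity, by
      rw [one_div]; exact inv_mul_cancel₀ (by positivity)⟩
  refine ⟨ℓ, 1 / 2, 1 / 2, hℓ, by norm_num, by norm_num, ?_⟩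
  -- `L_N → ∞`
  have hLt : Tendsto (fun n : ℕ =>
      Literature.MathematicalPhysics.QuantumManyBody.BoseGas.sideLength ρ (n + 1)) atTop atTop := by
    unfold Literature.MathematicalPhysics.QuantumManyBody.BoseGas.sideLength
    exact (tendsto_rpow_atTop (by norm_num : (0 : ℝ) < 1 / 3)).comp
      ((tendsto_natCast_atTop_atTop.comp (tendsto_add_atTop_nat 1)).atTop_div_const hρpos)
  filter_upwards [hev, hLt.eventually_ge_atTop (2 * ℓ)] with n hEn hLn
  refine ⟨1, one_pos, fun Ψ hΨ _hpos => ?_⟩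
  intro L m
  -- geometry of the partition: `m ≥ 1` and `L/m ≤ 2ℓ`
  have hL2 : 2 * ℓ ≤ L := hLn
  have hLpos : 0 < L := by linarith
  have hx : (1 : ℝ) ≤ L / ℓ := by rw [le_div_iff₀ hℓ]; linarith
  have hmpos : 0 < m := Nat.floor_pos.mpr hx
  have hmR : (0 : ℝ) < m := by exact_mod_cast hmpos
  have hm1 : L / ℓ < (m : ℝ) + 1 := Nat.lt_floor_add_one _
  have hsm : L / m ≤ 2 * ℓ := by
    rw [div_le_iff₀ hmR]
    have h' : L < ((m : ℝ) + 1) * ℓ := by rwa [div_lt_iff₀ hℓ] at hm1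
    nlinarith
  -- energy bookkeeping: `K ≤ E + 1`
  have hN0 : ((n + 1 : ℕ) : ENNReal) ≠ 0 := by exact_mod_cast Nat.succ_ne_zero n
  have hNtop : ((n + 1 : ℕ) : ENNReal) ≠ ⊤ := ENNReal.natCast_ne_top (n + 1)
  have h1N : (1 : ENNReal) ≤ ((n + 1 : ℕ) : ENNReal) := by exact_mod_cast Nat.le_add_left 1 n
  have hKle : (∫⁻ X : Fin n → EuclideanSpace ℝ (Fin 3), ∫⁻ y : EuclideanSpace ℝ (Fin 3),
      Literature.MathematicalPhysics.QuantumManyBody.BoseGas.partialGradSq 0 Ψ.ψ (Matrix.vecCons y X)) ≤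
        ENNReal.ofReal (E + 1) := by
    have hA : ((n + 1 : ℕ) : ENNReal) *
        (∫⁻ X : Fin n → EuclideanSpace ℝ (Fin 3), ∫⁻ y : EuclideanSpace ℝ (Fin 3),
          Literature.MathematicalPhysics.QuantumManyBody.BoseGas.partialGradSq 0 Ψ.ψ (Matrix.vecCons y X)) ≤
        ENNReal.ofReal E * ((n + 1 : ℕ) : ENNReal) + 1 :=
      (h2 v n L Ψ).trans (hΨ.trans (add_le_add_left hEn 1))
    have hB : ENNReal.ofReal E * ((n + 1 : ℕ) : ENNReal) + 1 ≤
        ENNReal.ofReal (E + 1) * ((n + 1 : ℕ) : ENNReal) := by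
      rw [ENNReal.ofReal_add hE.le zero_le_one, ENNReal.ofReal_one, add_mul, one_mul]
      exact add_le_add_right h1N _
    have hC' := hA.trans hB
    rw [mul_comm (ENNReal.ofReal (E + 1))] at hC'
    exact (ENNReal.mul_le_mul_iff_right hN0 hNtop).mp hC'
  -- the real inequality behind `θ = 1/2`
  have hreal : C * (L / m) ^ 2 / (1 - 1 / 2) * (E + 1) ≤ 1 / 2 := by
    have hsq : (L / m) ^ 2 ≤ (2 * ℓ) ^ 2 := pow_le_pow_left₀ (by positivity) hsm 2
    have key : 16 * C * ℓ ^ 2 * (E + 1) ≤ 16 * ℓ ^ 2 * (C + 1) ^ 2 * (E + 1) ^ 2 := by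
      have e1 : C ≤ (C + 1) ^ 2 := by nlinarith
      have e2 : E + 1 ≤ (E + 1) ^ 2 := by nlinarith
      calc 16 * C * ℓ ^ 2 * (E + 1) = 16 * ℓ ^ 2 * (C * (E + 1)) := by ring
        _ ≤ 16 * ℓ ^ 2 * ((C + 1) ^ 2 * (E + 1) ^ 2) := by gcongr
        _ = 16 * ℓ ^ 2 * (C + 1) ^ 2 * (E + 1) ^ 2 := by ring
    have key2 : 16 * ℓ ^ 2 * (C + 1) ^ 2 * (E + 1) ^ 2 = 1 := by
      calc 16 * ℓ ^ 2 * (C + 1) ^ 2 * (E + 1) ^ 2 = (ℓ * (4 * (C + 1) * (E + 1))) ^ 2 := by ring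
        _ = 1 := by rw [hu]; norm_num
    have h3' : C * (L / m) ^ 2 / (1 - 1 / 2) * (E + 1) = 2 * (E + 1) * C * (L / m) ^ 2 := by ring
    rw [h3']
    calc 2 * (E + 1) * C * (L / m) ^ 2 ≤ 2 * (E + 1) * C * (2 * ℓ) ^ 2 :=
          mul_le_mul_of_nonneg_left hsq (by positivity)
      _ = (16 * C * ℓ ^ 2 * (E + 1)) / 2 := by ring
      _ ≤ 1 / 2 := by linarith [key, key2]
  have hpos' : (0 : ℝ) ≤ C * (L / m) ^ 2 / (1 - 1 / 2) := by
    rw [show (1 : ℝ) - 1 / 2 = 1 / 2 by norm_num]; positivity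
  -- the chain
  have hmain := hbad n L m (1 / 2) Ψ hLpos hmpos (by norm_num) (by norm_num)
  calc _ ≤ _ := hmain
    _ ≤ ENNReal.ofReal (C * (L / m) ^ 2 / (1 - 1 / 2)) * ENNReal.ofReal (E + 1) :=
        mul_le_mul_right hKle _
    _ = ENNReal.ofReal (C * (L / m) ^ 2 / (1 - 1 / 2) * (E + 1)) := (ENNReal.ofReal_mul hpos').symm
    _ ≤ ENNReal.ofReal (1 / 2) := ENNReal.ofReal_le_ofReal hreal

/-- The crux MODULO THE THREE STUBS (hypothesis-free form): once the `sorry`s inside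
`stub_badMass_le_sliceKinetic`, `stub_sliceKinetic_le_energy`, `stub_groundStateEnergy_linear` are
discharged, this term is a proof of `BECRieszReverseHolder.MicroscaleFlatness` (concluded by name). -/
theorem MicroscaleFlatness_skeleton :
    Summit.AtomisticToContinuum.BoseEinsteinCondensation.Theses.BECRieszReverseHolder.MicroscaleFlatness :=
  MicroscaleFlatness_of stub_badMass_le_sliceKinetic stub_sliceKinetic_le_energy
    stub_groundStateEnergy_linear

end Summit.AtomisticToContinuum.BoseEinsteinCondensation.Cruxes.MicroscaleFlatness.Birth
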